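import Summits.QuantumFields.GaugeBoot.CutLoopProjectedPositivity
import Summits.QuantumFields.GaugeBoot.HaarShiftPlaquetteSignAllReps
import Summits.QuantumFields.GaugeBoot.ClassBStrongCouplingAllGroups
import Summits.QuantumFields.GaugeBoot.TiltedClassNegativeCouplingTwoDim
import HarnessLib

/-!
# Class B at negative coupling is inhabited IFF the representation of the action is trivial
(gauge-boot, Class B; all-representations form 3/3)

HONEST FRAMING (cell `pub-gaugeboot`, page 1 of every file): the venture produces certified bounds
on lattice expectations at stated coupling, gauge group, dimension and torus size; NOT a mass gap,
NOT a continuum limit, NOT a string tension; NOT Yang–Mills-summit-bearing (barriers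
`FixedCouplingUltralocality`, `PerturbativeInvisibility`). Structural statement for the Class-B
column (SCOPING A18): the cell has no certificate at `β < 0`; nothing at `β ≥ 0` changes.

## Content

`ClassBNegativeCouplingEmpty.lean` (central scalar `ω ≠ 1`) and `HaarShiftPlaquetteSign.lean`
(`ρ` without invariant vectors) proved that Class B is empty at `β < 0`. With the all-representation
forms 1/3 and 2/3 the hypothesis on `ρ` disappears:

* ★★★ **`false_of_translationInvariant_haarShift_diagRP_of_neg_of_ne_one`** — `G` compact
  metrisable, `ρ` continuous and NON-TRIVIAL (`∃ g, Re tr ρ(g) ≠ N`, i.e. `∃ g, ρ g ≠ 1` by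
  `eq_one_of_re_trace_eq_card`), `d ≥ 2`, `β < 0`: NO probability measure on `LGConfig d G` is
  translation invariant + one-link Haar-shift at `β` + reflection positive in every diagonal mirror.
  (Diagonal RP and translation invariance give `u_p ≥ m₀(ρ)` for every plaquette,
  `CutLoopProjectedPositivity`; the DLR sign rule gives `Σ_{p ∋ e} u_p < #{p ∋ e} m₀(ρ)`,
  `HaarShiftPlaquetteSignAllReps`.)
* ★★★ **`ClassBState.false_of_neg_of_ne_one`** / **`isEmpty_classBState_of_neg_of_ne_one`**;
  ★★ `exists_not_diagRP_of_mem_infiniteVolumeLimitPoints_of_neg_of_ne_one` (every torus limit point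
  at `β < 0` violates some diagonal RP), ★★★ `not_torusLimitPointsDiagonalRP_of_neg_of_ne_one`,
  ★★★ `not_thermodynamicLimitIsClassB_of_neg_of_ne_one` — the two OPEN `Prop`s of `ClassB.lean` are
  FALSE at `β < 0` for EVERY non-trivial `ρ`; `isEmpty_classBState_of_neg_of_injective` (any
  faithful `ρ` of a non-trivial group).
* `IsHaarShiftState.of_trivial`, `nonempty_classBState_of_trivial` — for the TRIVIAL representation
  the Haar-shift identity does not see `β`, so Class-B states at `β` are those at `β = 0`;
* ★★★ **`nonempty_classBState_iff_of_neg`** — THE CLASSIFICATION: `G` compact metrisable (in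
  `Type`), `ρ` continuous, `d ≥ 2`, `β < 0`: `Nonempty (ClassBState d ρ β) ↔ ∀ g, ρ g = 1`
  (inhabitation for trivial `ρ` from the tree's `nonempty_classBState_allGroups` at `β = 0`).

* ★★★ **`nonempty_classBState_two_iff_all`**, ★★★ **`TiltedRP.nonempty_tiltedClassState_two_iff_all`**
  — in TWO dimensions the classification is complete in `β ∈ ℝ` for every `ρ` and every compact
  metrisable `G`: Class B, resp. Class T (one diagonal RP + swap), is inhabited iff
  `0 ≤ β ∨ ρ trivial` (`β ≥ 0`: tilted-box limit states, tree `TiltedRP.nonempty_classBState_of_two`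
  / `nonempty_tiltedClassState`).

Kazakov–Zheng's infinite-volume axioms (translation invariance + one-link Schwinger–Dyson/DLR +
`R_diag`) are therefore inconsistent at negative coupling for every genuine lattice gauge theory; the
torus states exist at every `β`, so at `β < 0` they never acquire all diagonal RPs in the limit. Not
in print as far as the cell's searches go. [folklore]-level tools only.
-/

open MeasureTheory Complex Finset Function
open scoped ComplexOrder

namespace Summit.QuantumFields.GaugeBoot

open Literature.MathematicalPhysics.QuantumFieldTheory (haarProbability)
open Literature.MathematicalPhysics.QuantumLattice
open Literature.RepresentationTheory.CompactGroups

noncomputable section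

variable {d N : ℕ} {G : Type*} [Group G] [TopologicalSpace G] [IsTopologicalGroup G]
  [CompactSpace G] [MeasurableSpace G] [BorelSpace G] (ρ : G →* Matrix (Fin N) (Fin N) ℂ)

/-! ## The trivial representation: the Haar-shift identity does not see `β` -/

section Trivial

omit [TopologicalSpace G] [IsTopologicalGroup G] [CompactSpace G] [MeasurableSpace G] [BorelSpace G] in
/-- For the trivial representation every plaquette observable is the constant `N`. -/
theorem plaquetteObs_of_trivial (hρ1 : ∀ g, ρ g = 1) (x : Fin d → ℤ) (i j : Fin d)
    (U : LGConfig d G) : plaquetteObs ρ x i j U = N := by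
  simp [plaquetteObs, hρ1, Matrix.trace_one]

omit [TopologicalSpace G] [IsTopologicalGroup G] [CompactSpace G] [MeasurableSpace G] [BorelSpace G] in
/-- For the trivial representation the boundary Wilson action vanishes identically. -/
theorem wilsonBoundaryAction_of_trivial (hρ1 : ∀ g, ρ g = 1) (Λ : Finset (ZdEdge d))
    (U : LGConfig d G) : wilsonBoundaryAction ρ Λ U = 0 := by
  simp [wilsonBoundaryAction, plaquetteObs_of_trivial ρ hρ1]

omit [IsTopologicalGroup G] [CompactSpace G] [BorelSpace G] in
/-- **For the trivial representation the one-link Haar-shift identity is the same at every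
coupling**: a Haar-shift state at `β'` is one at `β`. -/
theorem IsHaarShiftState.of_trivial (hρ1 : ∀ g, ρ g = 1) {β β' : ℝ} {μ : Measure (LGConfig d G)}
    (h : IsHaarShiftState ρ β' μ) : IsHaarShiftState ρ β μ := by
  intro e g f S hS hf
  have h1 := h e g f S hS hf
  simp only [wilsonBoundaryAction_of_trivial ρ hρ1, sub_self, mul_zero, neg_zero, Real.exp_zero,
    mul_one] at h1 ⊢
  exact h1

omit [IsTopologicalGroup G] [CompactSpace G] [BorelSpace G] in
/-- Hence for the trivial representation Class-B states at `β'` are Class-B states at `β`. -/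
theorem nonempty_classBState_of_trivial (hρ1 : ∀ g, ρ g = 1) {β β' : ℝ}
    (h : Nonempty (ClassBState d ρ β')) : Nonempty (ClassBState d ρ β) := by
  obtain ⟨w⟩ := h
  refine ⟨?_⟩
  exact
    { μ := w.μ
      isProbabilityMeasure := w.isProbabilityMeasure
      translationInvariant := w.translationInvariant
      permInvariant := w.permInvariant
      reflectInvariant := w.reflectInvariant
      haarShift := IsHaarShiftState.of_trivial ρ hρ1 w.haarShift
      siteRP := w.siteRP
      linkRP := w.linkRP
      diagRP := w.diagRP }

omit [MeasurableSpace G] [BorelSpace G] in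
/-- A non-identity value has a non-maximal character: `ρ g ≠ 1 → Re tr ρ(g) ≠ N`. -/
theorem re_trace_ne_card_of_ne_one (hρ : Continuous ρ) {g : G} (hg : ρ g ≠ 1) :
    ((ρ g).trace).re ≠ N :=
  fun h => hg (eq_one_of_re_trace_eq_card ρ hρ g h)

end Trivial

/-! ## Non-trivial representations: no translation-invariant diagonally-RP DLR state at `β < 0` -/

section Negative

variable [SecondCountableTopology G]

/-- ★★★ **At `β < 0` no state is translation invariant, one-link Haar-shift and diagonally RP in
all planes — for EVERY non-trivial representation.** `G` compact metrisable; `ρ` continuous with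
`Re tr ρ(g) ≠ N` for some `g`; `d ≥ 2`; `β < 0`; `μ` a probability measure on `LGConfig d G` that is
translation invariant, satisfies the Haar-shift identity at `β`, and is reflection positive for every
diagonal mirror `x_i = x_j`. Then `False`: each plaquette through the link `e = (0, e_0)` has
`u_p ≥ m₀(ρ)` (projected cut positivity + translation invariance) while the DLR sign rule gives
`Σ_{p ∋ e} u_p < #{p ∋ e} · m₀(ρ)`. -/
theorem false_of_translationInvariant_haarShift_diagRP_of_neg_of_ne_one (hρ : Continuous ρ)
    (hρ1 : ∃ g, ((ρ g).trace).re ≠ N) (hd : 2 ≤ d) {β : ℝ} (hβ : β < 0)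
    {μ : Measure (LGConfig d G)} [IsProbabilityMeasure μ] (hT : IsZdTranslationInvariant μ)
    (hH : IsHaarShiftState ρ β μ)
    (hRP : ∀ i j : Fin d, i ≠ j →
      IsReflectionPositiveFor (configDiagSwapZd (G := G) i j) (diagHalfEdges i j) μ) : False := by
  set e : ZdEdge d := ((0 : Fin d → ℤ), (⟨0, by omega⟩ : Fin d)) with he
  have hlt := hH.sum_integral_plaquetteObs_lt_of_neg ρ hρ hρ1 hd hβ e
  have hge : ∀ p ∈ plaquettesTouching ({e} : Finset (ZdEdge d)),
      ∫ g, ((ρ g).trace).re ∂(haarProbability G) ≤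
        ∫ U, plaquetteObs ρ p.1 p.2.1.1 p.2.1.2 U ∂μ := by
    intro p _
    have hp : p.2.1.1 ≠ p.2.1.2 := ne_of_lt p.2.2
    have h0 := integral_re_trace_plaquette_ge_of_isReflectionPositiveFor_diag ρ hρ hp (hRP _ _ hp)
    -- translation invariance moves the plaquette to the origin of its plane
    have hTr : ∫ U, plaquetteObs ρ p.1 p.2.1.1 p.2.1.2 U ∂μ =
        ∫ U, (ρ (plaquetteHolonomyZd U 0 p.2.1.1 p.2.1.2)).trace.re ∂μ := by
      conv_lhs => rw [← hT p.1]
      rw [integral_map_equiv]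
      refine integral_congr_ae (ae_of_all _ fun U => ?_)
      have h := plaquetteHolonomyZd_configShift_add p.1 U 0 p.2.1.1 p.2.1.2
      rw [zero_add] at h
      simp only [plaquetteObs, h]
    rw [hTr]
    exact h0
  have hsum := Finset.sum_le_sum hge
  rw [Finset.sum_const, nsmul_eq_mul] at hsum
  linarith

/-- ★★★ **Class B is empty at `β < 0` for every non-trivial representation** (`G` compact
metrisable, `ρ` continuous with `∃ g, Re tr ρ(g) ≠ N`, `d ≥ 2`). Supersedes
`ClassBState.false_of_neg` (central scalar) and `ClassBState.false_of_neg'` (no invariant vectors). -/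
theorem ClassBState.false_of_neg_of_ne_one (hρ : Continuous ρ) (hρ1 : ∃ g, ((ρ g).trace).re ≠ N)
    (hd : 2 ≤ d) {β : ℝ} (hβ : β < 0) (w : ClassBState d ρ β) : False := by
  haveI := w.isProbabilityMeasure
  exact false_of_translationInvariant_haarShift_diagRP_of_neg_of_ne_one ρ hρ hρ1 hd hβ
    w.translationInvariant w.haarShift w.diagRP

/-- ★★★ `ClassBState d ρ β` is an empty type for `β < 0` and every non-trivial `ρ` (`d ≥ 2`). -/
theorem isEmpty_classBState_of_neg_of_ne_one (hρ : Continuous ρ) (hρ1 : ∃ g, ((ρ g).trace).re ≠ N)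
    (hd : 2 ≤ d) {β : ℝ} (hβ : β < 0) : IsEmpty (ClassBState d ρ β) :=
  ⟨fun w => ClassBState.false_of_neg_of_ne_one ρ hρ hρ1 hd hβ w⟩

/-- ★★ **Every faithful representation of a non-trivial compact metrisable group has empty Class B
at `β < 0`** (`ρ` continuous and injective, `d ≥ 2`). -/
theorem isEmpty_classBState_of_neg_of_injective [Nontrivial G] (hρ : Continuous ρ)
    (hinj : Function.Injective ρ) (hd : 2 ≤ d) {β : ℝ} (hβ : β < 0) :
    IsEmpty (ClassBState d ρ β) := by
  obtain ⟨g, hg⟩ := exists_ne (1 : G)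
  have hρg : ρ g ≠ 1 := fun h => hg (hinj (by rw [h, map_one]))
  exact isEmpty_classBState_of_neg_of_ne_one ρ hρ ⟨g, re_trace_ne_card_of_ne_one ρ hρ hρg⟩ hd hβ

/-- ★★ **Every infinite-volume limit point of the torus Wilson states violates some diagonal RP at
`β < 0`**, for every non-trivial `ρ` (they are translation-invariant Haar-shift states, tree). -/
theorem exists_not_diagRP_of_mem_infiniteVolumeLimitPoints_of_neg_of_ne_one [NeZero d] [T2Space G]
    (hρ : Continuous ρ) (hρ1 : ∃ g, ((ρ g).trace).re ≠ N) (hd : 2 ≤ d) {β : ℝ} (hβ : β < 0)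
    {μ : Measure (LGConfig d G)} (hμ : μ ∈ infiniteVolumeLimitPoints (d := d) ρ β) :
    ∃ i j : Fin d, i ≠ j ∧
      ¬ IsReflectionPositiveFor (configDiagSwapZd (G := G) i j) (diagHalfEdges i j) μ := by
  obtain ⟨hprob, htrans, -, -, hhaar⟩ := classBInvariances_of_mem_infiniteVolumeLimitPoints ρ hρ hμ
  by_contra h
  push Not at h
  exact false_of_translationInvariant_haarShift_diagRP_of_neg_of_ne_one ρ hρ hρ1 hd hβ htrans hhaar
    fun i j hij => h i j hij

/-- ★★★ **`TorusLimitPointsDiagonalRP d ρ β` is FALSE for `β < 0` and every non-trivial `ρ`.** -/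
theorem not_torusLimitPointsDiagonalRP_of_neg_of_ne_one [NeZero d] [T2Space G] (hρ : Continuous ρ)
    (hρ1 : ∃ g, ((ρ g).trace).re ≠ N) (hd : 2 ≤ d) {β : ℝ} (hβ : β < 0) :
    ¬ TorusLimitPointsDiagonalRP d ρ β := by
  intro h
  obtain ⟨μ, hμ⟩ := infiniteVolumeLimitPoints_nonempty_holds (d := d) ρ hρ β
  obtain ⟨i, j, hij, hnot⟩ :=
    exists_not_diagRP_of_mem_infiniteVolumeLimitPoints_of_neg_of_ne_one ρ hρ hρ1 hd hβ hμ
  exact hnot (h μ hμ i j hij)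

/-- ★★★ **`ThermodynamicLimitIsClassB d ρ β` is FALSE for `β < 0` and every non-trivial `ρ`.** -/
theorem not_thermodynamicLimitIsClassB_of_neg_of_ne_one [NeZero d] [T2Space G] (hρ : Continuous ρ)
    (hρ1 : ∃ g, ((ρ g).trace).re ≠ N) (hd : 2 ≤ d) {β : ℝ} (hβ : β < 0) :
    ¬ ThermodynamicLimitIsClassB d ρ β := by
  intro h
  obtain ⟨μ, hμ⟩ := infiniteVolumeLimitPoints_nonempty_holds (d := d) ρ hρ β
  obtain ⟨w, -⟩ := h μ hμ
  exact ClassBState.false_of_neg_of_ne_one ρ hρ hρ1 hd hβ w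

end Negative

/-! ## The classification at negative coupling -/

section Classification

/-- ★★★ **CLASS B AT NEGATIVE COUPLING IS INHABITED IFF THE REPRESENTATION IS TRIVIAL.** `G` a
compact metrisable group, `ρ : G → M_N(ℂ)` continuous, `d ≥ 2`, `β < 0`:
`Nonempty (ClassBState d ρ β) ↔ ∀ g, ρ g = 1`. (`→`: `isEmpty_classBState_of_neg_of_ne_one` with
`eq_one_of_re_trace_eq_card`; `←`: for the trivial representation the Haar-shift identity is
`β`-independent and Class B is inhabited at `β = 0`, tree `nonempty_classBState_allGroups`.) -/
theorem nonempty_classBState_iff_of_neg {d N : ℕ} {G : Type} [Group G] [TopologicalSpace G]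
    [IsTopologicalGroup G] [CompactSpace G] [MeasurableSpace G] [BorelSpace G] [T2Space G]
    [SecondCountableTopology G] (ρ : G →* Matrix (Fin N) (Fin N) ℂ) (hρ : Continuous ρ)
    (hd : 2 ≤ d) {β : ℝ} (hβ : β < 0) :
    Nonempty (ClassBState d ρ β) ↔ ∀ g, ρ g = 1 := by
  constructor
  · rintro ⟨w⟩
    by_contra h
    push Not at h
    obtain ⟨g, hg⟩ := h
    exact ClassBState.false_of_neg_of_ne_one ρ hρ ⟨g, re_trace_ne_card_of_ne_one ρ hρ hg⟩ hd hβ w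
  · intro h
    haveI : NeZero d := ⟨by omega⟩
    have h0 : Nonempty (ClassBState d ρ 0) :=
      nonempty_classBState_allGroups ρ hρ le_rfl (by simp)
    exact nonempty_classBState_of_trivial ρ h h0

/-- ★★★ The same in `IsEmpty` form: at `β < 0`, `ClassBState d ρ β` is empty iff `ρ g ≠ 1` for some
`g`. -/
theorem isEmpty_classBState_iff_of_neg {d N : ℕ} {G : Type} [Group G] [TopologicalSpace G]
    [IsTopologicalGroup G] [CompactSpace G] [MeasurableSpace G] [BorelSpace G] [T2Space G]
    [SecondCountableTopology G] (ρ : G →* Matrix (Fin N) (Fin N) ℂ) (hρ : Continuous ρ)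
    (hd : 2 ≤ d) {β : ℝ} (hβ : β < 0) :
    IsEmpty (ClassBState d ρ β) ↔ ∃ g, ρ g ≠ 1 := by
  rw [← not_nonempty_iff, nonempty_classBState_iff_of_neg ρ hρ hd hβ]
  push Not
  rfl

end Classification

/-! ## Two dimensions: the classification for every real `β` -/

section TwoDim

variable [T2Space G] [SecondCountableTopology G] {i j : Fin d}

/-- ★★★ **Class B in two dimensions, every representation, every real `β`**: for `G` compact
metrisable, `ρ` continuous and the two axes `i ≠ j` of `ℤ²`:
`Nonempty (ClassBState d ρ β) ↔ (0 ≤ β ∨ ∀ g, ρ g = 1)` (`β ≥ 0`: tilted-box limit states, tree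
`TiltedRP.nonempty_classBState_of_two`; `β < 0`: empty unless `ρ` is trivial, and then the `β = 0`
states qualify). Supersedes `nonempty_classBState_two_iff` (central scalar). -/
theorem nonempty_classBState_two_iff_all (hij : i ≠ j) (hd : ∀ k : Fin d, k = i ∨ k = j)
    (hρ : Continuous ρ) (β : ℝ) :
    Nonempty (ClassBState d ρ β) ↔ (0 ≤ β ∨ ∀ g, ρ g = 1) := by
  constructor
  · rintro ⟨w⟩
    by_contra h
    push Not at h
    obtain ⟨hβ, g, hg⟩ := h
    exact ClassBState.false_of_neg_of_ne_one ρ hρ ⟨g, re_trace_ne_card_of_ne_one ρ hρ hg⟩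
      (two_le_of_ne hij) hβ w
  · rintro (hβ | h)
    · exact TiltedRP.nonempty_classBState_of_two ρ hij hd hρ hβ
    · exact nonempty_classBState_of_trivial ρ h (TiltedRP.nonempty_classBState_of_two ρ hij hd hρ le_rfl)

namespace TiltedRP

omit [IsTopologicalGroup G] [CompactSpace G] [BorelSpace G] [T2Space G] [SecondCountableTopology G] in
/-- For the trivial representation Class-T states at `β'` are Class-T states at `β`. -/
theorem nonempty_tiltedClassState_of_trivial (hρ1 : ∀ g, ρ g = 1) {β β' : ℝ}
    (h : Nonempty (TiltedClassState d i j ρ β')) : Nonempty (TiltedClassState d i j ρ β) := by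
  obtain ⟨w⟩ := h
  refine ⟨?_⟩
  exact
    { μ := w.μ
      isProbabilityMeasure := w.isProbabilityMeasure
      translationInvariant := w.translationInvariant
      swapInvariant := w.swapInvariant
      reflectInvariant := w.reflectInvariant
      haarShift := IsHaarShiftState.of_trivial ρ hρ1 w.haarShift
      diagRP := w.diagRP
      siteRP := w.siteRP
      linkRP := w.linkRP }

omit [T2Space G] in
/-- ★★★ **No Class-T state in two dimensions at `β < 0` for any non-trivial `ρ`** (`G` compact
metrisable; supersedes `TiltedClassState.false_of_neg_two`, central scalar). -/
theorem TiltedClassState.false_of_neg_two_of_ne_one (hij : i ≠ j) (hd : ∀ k : Fin d, k = i ∨ k = j)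
    (hρ : Continuous ρ) (hρ1 : ∃ g, ((ρ g).trace).re ≠ N) {β : ℝ} (hβ : β < 0)
    (w : TiltedClassState d i j ρ β) : False := by
  haveI := w.isProbabilityMeasure
  exact false_of_translationInvariant_haarShift_diagRP_of_neg_of_ne_one ρ hρ hρ1 (two_le_of_ne hij)
    hβ w.translationInvariant w.haarShift (TiltedClassState.diagRP_all_of_two ρ hij hd w)

/-- ★★★ **Class T in two dimensions, every representation, every real `β`**:
`Nonempty (TiltedClassState d i j ρ β) ↔ (0 ≤ β ∨ ∀ g, ρ g = 1)` (`G` compact metrisable, `ρ`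
continuous, `i ≠ j` the two axes). Supersedes `nonempty_tiltedClassState_two_iff`. -/
theorem nonempty_tiltedClassState_two_iff_all (hij : i ≠ j) (hd : ∀ k : Fin d, k = i ∨ k = j)
    (hρ : Continuous ρ) (β : ℝ) :
    Nonempty (TiltedClassState d i j ρ β) ↔ (0 ≤ β ∨ ∀ g, ρ g = 1) := by
  constructor
  · rintro ⟨w⟩
    by_contra h
    push Not at h
    obtain ⟨hβ, g, hg⟩ := h
    exact TiltedClassState.false_of_neg_two_of_ne_one ρ hij hd hρ
      ⟨g, re_trace_ne_card_of_ne_one ρ hρ hg⟩ hβ w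
  · rintro (hβ | h)
    · exact nonempty_tiltedClassState ρ hij hρ hβ
    · exact nonempty_tiltedClassState_of_trivial ρ h (nonempty_tiltedClassState ρ hij hρ le_rfl)

end TiltedRP

end TwoDim

end

end Summit.QuantumFields.GaugeBoot
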